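import Summits.QuantumFields.YangMills.Theorems.UnitScaleTiltProp7HilbertTranslationT3
import Summits.QuantumFields.YangMills.Theorems.UnitScaleTiltProp7CombGaugeKernelTranslate
import HarnessLib

/-!
# `UnitScaleTiltProp7CombFlatProjectorTransportT3` — ★★OWNER RULING №18 ON THE HILBERT LETTERS: **`N_c(1) = τ·N_S(1)` AND `R_c(1) ∘ τ = τ ∘ R_S(1)` AT THE FLAT MEMBER**, `τ` = the lattice
# translation by `−x₀` (`x₀ = basePt`), hence **COMB-FLAT COERCIVITY ⟸ THE SLICE BOUND (I3′) ALONE** — the projector row (hR) of ✓`Prop7HilbertTranslation.coercive_laplaceAc_one_of_sliceBound_translate`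
# DISCHARGED from px6 g5's kernel dictionary ✓`Prop7CombGaugeKernelTranslate.toL2S_mem_NSc_one_iff` (over ✓`Prop7CombBoxBlockDictionary.QTw_one_gaugeDir_eq_QTwS_transl`)
(route `UnitScaleTilt`, crux K1 «MinimiserStabilityRegPr» stmt-QuantumFields-19200; RULING №18 (2) «COMB-FLAT-COERCIVITY := FILE B ∘ τ + isometry transfer + (I3′) δQ-SLICE»; items (b1) «τ on the
Hilbert letters … `Rc 1 = τ RS 1 τ⁻¹` = the transport of the dictionary through `toL2S∕toL2B`, `covLapSite 1`'s translation invariance and `projR`» (px6 g5 2026-08-29T04:36:18Z ∕ 04:54:13Z, named for a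
successor) — this file; def-free, count-neutral).  Cell `ym3-torus` (HUMAN RULING D-0037, YM ladder rung R3 — YM₃ on T³ is a rung, not d = 4, not infinite volume, not a mass gap, not Clay), width seat
`ym3-torus-px13` (gen 6).

THE PRINT.  [Balaban1985BackgroundPropagators] (3.21) p. 394: `R(U)` = the orthogonal projection onto `Δ^η_U N(Q′)`, `N(Q′) = {λ : Q′λ = 0}`; (3.115) p. 418: `Q_jDλ = D̄ʲQ′_jλ` — «the averages QA are
invariant with respect to gauge transformations λ satisfying Q′λ = 0»; the route carries TWO averagings at the flat member — print's comb `QTw` (corner-anchored boxes at `x̂`) and the symmetric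
tube `QTwS` (T³ blocks centred at `x̂`) — whose flat gauge classes differ by the half-block translation (✓`Prop7CombChartFlatPureGauge`, ✓`Prop7CombBoxBlockDictionary`).

WHAT IS PROVED (sorry-free, no definition; member `F`, `n ≤ K`, weights `c₀ cB`, `x₀ := basePt F n K`, `M₂ := Matrix (Fin 2) (Fin 2) ℂ`):
* §1 [folklore ∕ Mathlib `Submodule.starProjection_map_apply`] ★★ `Rc_one_apply_of_NSc_eq_map` — for ANY linear isometric equivalence `e` of the gauge parameters commuting with `Δ^η_1` and with
  `N_c(1) = (N_S(1)).map e`: `R_c(1)(e u) = e (R_S(1) u)` (both are `starProjection`s onto `Δ^η_1 N(1)`, ✓`Rc_eq_projR`, ✓`RS_eq_projR`); ★★ `norm_Rc_one_translate_of_NSc_eq_map` — the norm row (hR).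
* §2 the KERNEL DICTIONARY on the Hilbert letters in Submodule form: `transl x (labels x₀) = x + x₀` (px6 g5's `t_{x₀}` IS the torus translation by `x₀`); `toL2S λ ∈ N_c(1) ↔ toL2S (λ(· + x₀)) ∈ N_S(1)`
  (= px6 g5's ✓`Prop7CombGaugeKernelTranslate.toL2S_mem_NSc_one_iff`, cited by name); ★★★ `NSc_one_eq_map_of_symm_translate` — `N_c(1) = (N_S(1)).map e` for every linear isometric equivalence `e`
  whose inverse acts as the translation by `x₀` on `toL2S λ` (the site isometry of ✓`exists_linearIsometryEquiv_translate (−x₀)`).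
* §3 ★★★ `coercive_laplaceAc_one_of_sliceBound_basePt` — COMB-FLAT COERCIVITY at the flat member from FILE B (inside ✓p695948) and ONE displayed row, the slice bound
  (hv) `a‖Q_kᶜ(1)(toL2 (X(· − x₀))) − Q_k(1)(toL2 X)‖² ≤ ρ·(re⟨toL2 X, Δ^η(1) toL2 X⟩ + ‖R_S(1)D*_1 toL2 X‖²)` ((I3′), pen w4 g8), constant `1∕(4·Cst 3 a₀·(2+2ρ))`.
HONEST FRAMING.  Bookkeeping (projector transport + kernel dictionary); no estimate; (hv) displayed, not proved — the K-uniformity of COMB-FLAT COERCIVITY lives entirely in (I3′)'s `ρ`; nothing of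
HESS ∕ E′ ∕ EX ∕ the crux K1 is proved; rung R3, not Clay; YM gap NOT proved.  `--supports stmt-QuantumFields-19200 --as helper`.
References: T. Bałaban, CMP 99 (1985) 389–434 [Balaban1985BackgroundPropagators] ((3.21)–(3.23) p.394, (3.115) p.418, Thm 3.11 p.416, (3.26) p.395); CMP 95 (1984) 17–40 [Balaban1984PropagatorsI]
((1.4) p.18, (1.20) p.20, Prop. 1.1 (1.90) p.33); CMP 96 (1984) 223–250 [Balaban1984PropagatorsII] ((2.10)–(2.12) pp.224–225); CMP 109 (1987) 249–301 [Balaban1987RG1] ((0.1) p.251).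
-/

noncomputable section

open scoped InnerProductSpace ComplexConjugate Matrix.Norms.L2Operator BigOperators

namespace Summit.QuantumFields.YangMills.Theorems.Prop7CombFlatProjectorTransport

open Literature.MathematicalPhysics.QuantumFieldTheory.Balaban1983to89
open Literature.MathematicalPhysics.QuantumFieldTheory.Balaban1983to89.T3ContinuumYM3Torus
open T3SectALandauChart (eta)
open B9Eq311L2Pairing (WL2)
open B11Eq103H1Complex (SiteL2K BondL2K)
open B10Eq27TorusAxialLog (transl transl_apply)
open Summit.QuantumFields.YangMills.Theorems.Prop7SectET3Transport (periodsT3)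
open Summit.QuantumFields.YangMills.Theorems.Prop7SectET3HilbertLetters (W₂ toL2 toL2S toL2B DL2 DstarL2 covLapSite)
open Summit.QuantumFields.YangMills.Theorems.Prop7SectET3GaugeProjector (RS NS QDS RS_eq_projR)
open Summit.QuantumFields.YangMills.Theorems.Prop7SectET3WilsonHessian (DeltaEta)
open Summit.QuantumFields.YangMills.Theorems.Prop7SectET3CurvedPropagators (Qk)
open Summit.QuantumFields.YangMills.Theorems.Prop7SectET3CombLetters (Rc Qkc laplaceAc NSc QDc Rc_eq_projR)
open Summit.QuantumFields.YangMills.Theorems.Prop7SPrint (basePt)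
open Summit.QuantumFields.YangMills.Theorems.Prop7CombGaugeKernelTranslate (toL2S_mem_NSc_one_iff)
open Summit.QuantumFields.YangMills.Theorems.Prop7HilbertTranslation (exists_linearIsometryEquiv_translate coercive_laplaceAc_one_of_sliceBound_translate)

/-! ## §1 The projector transport: `R_c(1) ∘ e = e ∘ R_S(1)` for an isometry `e` commuting with `Δ^η_1` and carrying `N_S(1)` onto `N_c(1)` -/

section Transport

variable {F : T3Family} {n K : ℕ} {c₀ : ℝ} [Fact (0 < c₀)]

/-- Orthogonal projections onto EQUAL subspaces agree (the `HasOrthogonalProjection` instances are propositions). [folklore] -/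
theorem starProjection_eq_of_eq {E : Type*} [NormedAddCommGroup E] [InnerProductSpace ℂ E] {K₁ K₂ : Submodule ℂ E}
    [K₁.HasOrthogonalProjection] [K₂.HasOrthogonalProjection] (hK : K₁ = K₂) (x : E) : K₁.starProjection x = K₂.starProjection x := by
  subst hK
  rfl

/-- ★★ **THE GAUGE PROJECTOR TRANSPORTED BY AN ISOMETRY** (RULING №18 «`Rc 1 = τ RS 1 τ⁻¹`», its Hilbert-space half): if a linear isometric equivalence `e` of the gauge parameters commutes
with `Δ^η_1` and carries the S residual gauge algebra onto the comb one, `N_c(1) = e·N_S(1)`, then `R_c(1)(e u) = e (R_S(1) u)` — both projectors are Mathlib's `starProjection` onto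
`Δ^η_1 N(1)` (✓`Rc_eq_projR`, ✓`RS_eq_projR`, lit `B11Eq103H1Complex.projR`), and `(e·N_S).map Δ = (N_S.map Δ).map e`; Mathlib `Submodule.starProjection_map_apply`.  With §3's
`exists_linearIsometryEquiv_translate` §2 supplies the kernel dictionary `N_c(1) = τS·N_S(1)` from px6 g5's letter-level identity. [cite: Balaban1985BackgroundPropagators, (3.21)–(3.23) p.394, (3.115) p.418] -/
theorem Rc_one_apply_of_NSc_eq_map {h : n ≤ K} {cB : ℝ} [Fact (0 < cB)]
    (e : SiteL2K ℂ 3 (periodsT3 F K) c₀ W₂ ≃ₗᵢ[ℂ] SiteL2K ℂ 3 (periodsT3 F K) c₀ W₂)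
    (he : ∀ u, covLapSite F n K c₀ 1 (e u) = e (covLapSite F n K c₀ 1 u))
    (hN : NSc F n K h c₀ cB (1 : GaugeField (F.P K) 0 (Matrix.specialUnitaryGroup (Fin 2) ℂ))
      = (NS F n K h c₀ cB (1 : GaugeField (F.P K) 0 (Matrix.specialUnitaryGroup (Fin 2) ℂ))).map (e.toLinearEquiv : SiteL2K ℂ 3 (periodsT3 F K) c₀ W₂ →ₗ[ℂ] SiteL2K ℂ 3 (periodsT3 F K) c₀ W₂))
    (u : SiteL2K ℂ 3 (periodsT3 F K) c₀ W₂) :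
    Rc F n K h c₀ cB (1 : GaugeField (F.P K) 0 (Matrix.specialUnitaryGroup (Fin 2) ℂ)) (e u)
      = e (RS F n K h c₀ cB (1 : GaugeField (F.P K) 0 (Matrix.specialUnitaryGroup (Fin 2) ℂ)) u) := by
  -- the two ranges: `(ker QDc 1).map Δ = ((ker QDS 1).map Δ).map e`
  have hcomm : covLapSite F n K c₀ 1 ∘ₗ (e.toLinearEquiv : SiteL2K ℂ 3 (periodsT3 F K) c₀ W₂ →ₗ[ℂ] SiteL2K ℂ 3 (periodsT3 F K) c₀ W₂)
      = (e.toLinearEquiv : SiteL2K ℂ 3 (periodsT3 F K) c₀ W₂ →ₗ[ℂ] SiteL2K ℂ 3 (periodsT3 F K) c₀ W₂) ∘ₗ covLapSite F n K c₀ 1 :=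
    LinearMap.ext fun u => he u
  have hK : (LinearMap.ker (QDc F n K h c₀ cB (1 : GaugeField (F.P K) 0 (Matrix.specialUnitaryGroup (Fin 2) ℂ)))).map (covLapSite F n K c₀ 1)
      = ((LinearMap.ker (QDS F n K h c₀ cB (1 : GaugeField (F.P K) 0 (Matrix.specialUnitaryGroup (Fin 2) ℂ)))).map (covLapSite F n K c₀ 1)).map
          (e.toLinearEquiv : SiteL2K ℂ 3 (periodsT3 F K) c₀ W₂ →ₗ[ℂ] SiteL2K ℂ 3 (periodsT3 F K) c₀ W₂) := by
    change (NSc F n K h c₀ cB 1).map _ = ((NS F n K h c₀ cB 1).map _).map _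
    rw [hN, ← Submodule.map_comp, ← Submodule.map_comp, hcomm]
  haveI : CompleteSpace ↥((LinearMap.ker (QDS F n K h c₀ cB (1 : GaugeField (F.P K) 0 (Matrix.specialUnitaryGroup (Fin 2) ℂ)))).map (covLapSite F n K c₀ 1)) :=
    FiniteDimensional.complete ℂ _
  haveI : CompleteSpace ↥((LinearMap.ker (QDc F n K h c₀ cB (1 : GaugeField (F.P K) 0 (Matrix.specialUnitaryGroup (Fin 2) ℂ)))).map (covLapSite F n K c₀ 1)) :=
    FiniteDimensional.complete ℂ _
  rw [Rc_eq_projR, RS_eq_projR]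
  simp only [B11Eq103H1Complex.projR, ContinuousLinearMap.coe_coe]
  rw [starProjection_eq_of_eq hK (e u), Submodule.starProjection_map_apply, LinearIsometryEquiv.symm_apply_apply]

/-- ★★ Row (hR) of ✓`coercive_laplaceAc_one_of_sliceBound_translate` FROM THE KERNEL DICTIONARY: with the site isometry of ✓`exists_linearIsometryEquiv_translate` (any `e` acting as the translation by `v` on `toL2S λ` and commuting with `Δ^η_1`)
and `N_c(1) = e·N_S(1)`, `‖R_c(1)(toL2S (λ(· + v)))‖ = ‖R_S(1)(toL2S λ)‖`. [cite: Balaban1985BackgroundPropagators, (3.21) p.394] -/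
theorem norm_Rc_one_translate_of_NSc_eq_map {h : n ≤ K} {cB : ℝ} [Fact (0 < cB)] (v : Site (F.P K) 0)
    (e : SiteL2K ℂ 3 (periodsT3 F K) c₀ W₂ ≃ₗᵢ[ℂ] SiteL2K ℂ 3 (periodsT3 F K) c₀ W₂)
    (heS : ∀ lam : Site (F.P K) 0 → Matrix (Fin 2) (Fin 2) ℂ, e (toL2S F K c₀ lam) = toL2S F K c₀ (fun x => lam (x + v)))
    (he : ∀ u, covLapSite F n K c₀ 1 (e u) = e (covLapSite F n K c₀ 1 u))
    (hN : NSc F n K h c₀ cB (1 : GaugeField (F.P K) 0 (Matrix.specialUnitaryGroup (Fin 2) ℂ))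
      = (NS F n K h c₀ cB (1 : GaugeField (F.P K) 0 (Matrix.specialUnitaryGroup (Fin 2) ℂ))).map (e.toLinearEquiv : SiteL2K ℂ 3 (periodsT3 F K) c₀ W₂ →ₗ[ℂ] SiteL2K ℂ 3 (periodsT3 F K) c₀ W₂))
    (lam : Site (F.P K) 0 → Matrix (Fin 2) (Fin 2) ℂ) :
    ‖Rc F n K h c₀ cB (1 : GaugeField (F.P K) 0 (Matrix.specialUnitaryGroup (Fin 2) ℂ)) (toL2S F K c₀ (fun x => lam (x + v)))‖
      = ‖RS F n K h c₀ cB (1 : GaugeField (F.P K) 0 (Matrix.specialUnitaryGroup (Fin 2) ℂ)) (toL2S F K c₀ lam)‖ := by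
  rw [← heS, Rc_one_apply_of_NSc_eq_map e he hN, LinearIsometryEquiv.norm_map]

end Transport


/-! ## §2 The kernel dictionary in Submodule form: `N_c(1) = τS(−x₀)·N_S(1)`, `x₀ = basePt` — px6 g5's ✓`toL2S_mem_NSc_one_iff` read through `t_{x₀} = · + x₀` -/

section Kernel

variable {F : T3Family} {n K : ℕ} {c₀ : ℝ} [Fact (0 < c₀)]

omit [Fact (0 < c₀)] in
/-- The dictionary's translation `t_{x₀} x = transl x (labels x₀)` IS the torus translation `x + x₀` (labels read back in `ZMod`: `((x₀ μ).val : ZMod) = x₀ μ`). [cite: Balaban1987RG1, (0.1) p.251] -/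
theorem transl_labels_eq_add (x x₀ : Site (F.P K) 0) :
    transl x (fun μ => (((x₀ μ).val : ℕ) : ℤ)) = x + x₀ := by
  funext ν
  rw [transl_apply, Int.cast_natCast, ZMod.natCast_zmod_val]
  rfl

/-- ★★ **MEMBERSHIP DICTIONARY, TORUS-TRANSLATION FORM**: `toL2S λ ∈ N_c(1) ↔ toL2S (λ(· + x₀)) ∈ N_S(1)` — px6 g5's ✓`Prop7CombGaugeKernelTranslate.toL2S_mem_NSc_one_iff` (stated with
`t_{x₀} x = transl x (labels x₀)`) read through `transl_labels_eq_add`. [cite: Balaban1985BackgroundPropagators, (3.21) p.394, (3.115) p.418] -/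
theorem toL2S_mem_NSc_one_iff_add {h : n ≤ K} {cB : ℝ} (lam : Site (F.P K) 0 → Matrix (Fin 2) (Fin 2) ℂ) :
    toL2S F K c₀ lam ∈ NSc F n K h c₀ cB (1 : GaugeField (F.P K) 0 (Matrix.specialUnitaryGroup (Fin 2) ℂ))
      ↔ toL2S F K c₀ (fun x => lam (x + basePt F n K)) ∈ NS F n K h c₀ cB (1 : GaugeField (F.P K) 0 (Matrix.specialUnitaryGroup (Fin 2) ℂ)) := by
  rw [toL2S_mem_NSc_one_iff F h lam]
  simp only [transl_labels_eq_add]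

/-- ★★★ **`N_c(1) = e·N_S(1)` FOR ANY EQUIVALENCE `e` WHOSE INVERSE ACTS AS THE TRANSLATION BY `x₀ = basePt`** on `toL2S λ` (e.g. the site isometry of `exists_linearIsometryEquiv_translate (−x₀)`):
★★OWNER RULING №18 «`N_c(1) = τ·N_S(1)`» on the Hilbert letters. [cite: Balaban1985BackgroundPropagators, (3.21) p.394, (3.115) p.418] -/
theorem NSc_one_eq_map_of_symm_translate {h : n ≤ K} {cB : ℝ} [Fact (0 < cB)]
    (e : SiteL2K ℂ 3 (periodsT3 F K) c₀ W₂ ≃ₗᵢ[ℂ] SiteL2K ℂ 3 (periodsT3 F K) c₀ W₂)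
    (he : ∀ lam : Site (F.P K) 0 → Matrix (Fin 2) (Fin 2) ℂ, e.symm (toL2S F K c₀ lam) = toL2S F K c₀ (fun x => lam (x + basePt F n K))) :
    NSc F n K h c₀ cB (1 : GaugeField (F.P K) 0 (Matrix.specialUnitaryGroup (Fin 2) ℂ))
      = (NS F n K h c₀ cB (1 : GaugeField (F.P K) 0 (Matrix.specialUnitaryGroup (Fin 2) ℂ))).map
          (e.toLinearEquiv : SiteL2K ℂ 3 (periodsT3 F K) c₀ W₂ →ₗ[ℂ] SiteL2K ℂ 3 (periodsT3 F K) c₀ W₂) := by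
  ext u
  obtain ⟨lam, rfl⟩ := (toL2S F K c₀).surjective u
  rw [toL2S_mem_NSc_one_iff_add, Submodule.mem_map_equiv]
  change _ ↔ e.symm (toL2S F K c₀ lam) ∈ _
  rw [he]

end Kernel

/-! ## §3 ★★★ COMB-FLAT COERCIVITY ⟸ THE SLICE BOUND ALONE -/

section Final

variable {F : T3Family} {n K : ℕ} {c₀ : ℝ} [Fact (0 < c₀)]

/-- ★★★ **COMB-FLAT COERCIVITY AT THE FLAT MEMBER FROM FILE B AND ONE DISPLAYED ROW — THE SLICE BOUND (I3′).**  For every `a₀ > 0` and every Hessian slot with `Δx 1 = Δ^η(1)`: if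
(hv) `a‖Q_kᶜ(1)(toL2 (X(· − x₀))) − Q_k(1)(toL2 X)‖² ≤ ρ·(re⟨toL2 X, Δ^η(1) toL2 X⟩ + ‖R_S(1)D*_1(toL2 X)‖²)` for every vector field `X` (`x₀ = basePt F n K`; the gradient-blind `δQ` of ★★OWNER RULING №18,
item (I3′)), then `(1∕(4·Cst 3 a₀·(2+2ρ)))·‖y‖² ≤ re⟨y, Δ_aᶜ(1) y⟩` for ALL `y`, `a = a₀·(c₀∕cB)·(L^{K−n})³`.  The projector row (hR) of ✓`coercive_laplaceAc_one_of_sliceBound_translate` is DISCHARGED: `N_c(1) = τS(−x₀)·N_S(1)` (§2, px6 g5's dictionary)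
and the projector transport (§1).  [cite: Balaban1985BackgroundPropagators, Thm 3.11 p.416, (3.26) p.395, (3.115) p.418; Balaban1984PropagatorsI, Prop. 1.1 (1.90) p.33] -/
theorem coercive_laplaceAc_one_of_sliceBound_basePt {h : n ≤ K} {cB : ℝ} [Fact (0 < cB)] {a₀ : ℝ} (ha₀ : 0 < a₀)
    (Δx : GaugeField (F.P K) 0 (Matrix.specialUnitaryGroup (Fin 2) ℂ) → (BondL2K ℂ 3 (periodsT3 F K) c₀ W₂ →ₗ[ℂ] BondL2K ℂ 3 (periodsT3 F K) c₀ W₂))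
    (hΔ : Δx 1 = (DeltaEta F n K c₀ 1 : BondL2K ℂ 3 (periodsT3 F K) c₀ W₂ →ₗ[ℂ] BondL2K ℂ 3 (periodsT3 F K) c₀ W₂))
    {ρ : ℝ} (hρ : 0 ≤ ρ)
    (hv : ∀ X : PBond (F.P K) 0 → Matrix (Fin 2) (Fin 2) ℂ,
      (a₀ * (c₀ / cB) * ((F.L : ℝ) ^ (K - n)) ^ 3)
          * ‖Qkc F n K h c₀ cB (1 : GaugeField (F.P K) 0 (Matrix.specialUnitaryGroup (Fin 2) ℂ)) (toL2 F K c₀ (fun b => X (b.translate (-basePt F n K))))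
              - Qk F n K h c₀ cB (1 : GaugeField (F.P K) 0 (Matrix.specialUnitaryGroup (Fin 2) ℂ)) (toL2 F K c₀ X)‖ ^ 2
        ≤ ρ * (RCLike.re ⟪toL2 F K c₀ X, Δx 1 (toL2 F K c₀ X)⟫_ℂ
              + ‖RS F n K h c₀ cB (1 : GaugeField (F.P K) 0 (Matrix.specialUnitaryGroup (Fin 2) ℂ))
                  (DstarL2 F n K c₀ (1 : GaugeField (F.P K) 0 (Matrix.specialUnitaryGroup (Fin 2) ℂ)) (toL2 F K c₀ X))‖ ^ 2))
    (y : BondL2K ℂ 3 (periodsT3 F K) c₀ W₂) :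
    (1 / (4 * B5Prop11Plancherel.Cst 3 a₀ * (2 + 2 * ρ))) * ‖y‖ ^ 2
      ≤ RCLike.re ⟪y, laplaceAc F n K h c₀ cB (a₀ * (c₀ / cB) * ((F.L : ℝ) ^ (K - n)) ^ 3) Δx
          (1 : GaugeField (F.P K) 0 (Matrix.specialUnitaryGroup (Fin 2) ℂ)) y⟫_ℂ := by
  obtain ⟨eS, eB, h1, h2, -, -, -, -, h7⟩ := exists_linearIsometryEquiv_translate (F := F) (n := n) (K := K) (c₀ := c₀) (-basePt F n K)
  have he : ∀ lam : Site (F.P K) 0 → Matrix (Fin 2) (Fin 2) ℂ, eS.symm (toL2S F K c₀ lam) = toL2S F K c₀ (fun x => lam (x + basePt F n K)) := by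
    intro lam
    rw [h2 lam, neg_neg]
  have hN := NSc_one_eq_map_of_symm_translate (h := h) (cB := cB) eS he
  exact coercive_laplaceAc_one_of_sliceBound_translate (h := h) (cB := cB) ha₀ Δx hΔ (-basePt F n K)
    (fun lam => norm_Rc_one_translate_of_NSc_eq_map (-basePt F n K) eS h1 h7 hN lam) hρ hv y

end Final

end Summit.QuantumFields.YangMills.Theorems.Prop7CombFlatProjectorTransport

end
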